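import Mathlib
import HarnessLib
import Summits.QuantumFields.QCD.Theses.PauliWegnerSea
import Literature.MathematicalPhysics.QuantumLattice.TwistedBoundaryConditions

/-!
# Sketch — crux-ideate stmt-QuantumFields-11511 (TiltedFlatness), ideator 2, round 1

First lemmas of the idea cards `Ideas/untilt-by-sandwich.md` and `Ideas/conjugate-twin-wells.md`.
Statements only (they must elaborate); nothing here is filed.
-/

open MeasureTheory Filter Set
open Literature.MathematicalPhysics.QuantumFieldTheory Literature.MathematicalPhysics.QuantumLattice
  Literature.Probability.LatticeModels

namespace Summit.QuantumFields.QCD.Cruxes.TiltedFlatness.Ideator2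

/-! ## Card `untilt-by-sandwich` -/

/-- FIRST LEMMA (abstract untilting sandwich). For a probability measure `μ`, a weight `e^{-βS}`
with `S ≥ m`, and any event `A`: the tilted probability of `A` is at most
`e · μ(A) / μ{S ≤ m + 1/β}`, and the tilted mean of a non-negative `F` is at least
`e⁻¹ ∫_{S ≤ m + 1/β} F dμ`. (Proof: `Z ≥ e^{-βm-1} μ{S ≤ m+1/β}`, numerator `≤ e^{-βm} μ(A)`;
`Z ≤ e^{-βm}`.) The hypothesis `0 < μ{S ≤ m + 1/β}` (automatic for Haar and continuous `S` with
`m = min S`) keeps the first quotient away from Lean's junk value `x / 0 = 0`. -/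
def UntiltSandwich : Prop :=
  ∀ (Ω : Type) [MeasurableSpace Ω] (μ : Measure Ω) [IsProbabilityMeasure μ] (S F : Ω → ℝ),
    Measurable S → Measurable F → (∀ ω, 0 ≤ F ω) → (∃ B, ∀ ω, F ω ≤ B) →
    ∀ (m β : ℝ), 0 < β → (∀ ω, m ≤ S ω) → 0 < (μ {ω | S ω ≤ m + 1 / β}).toReal →
      (∀ A : Set Ω, MeasurableSet A →
        (∫ ω in A, Real.exp (-(β * S ω)) ∂μ) / (∫ ω, Real.exp (-(β * S ω)) ∂μ)
          ≤ Real.exp 1 * (μ A).toReal / (μ {ω | S ω ≤ m + 1 / β}).toReal) ∧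
      Real.exp (-1) * (∫ ω in {ω | S ω ≤ m + 1 / β}, F ω ∂μ)
        ≤ (∫ ω, F ω * Real.exp (-(β * S ω)) ∂μ) / (∫ ω, Real.exp (-(β * S ω)) ∂μ)

/-- FIRST LEMMA (crux-specific half): the two-star sublevel set of the Wilson action at height
`1/β` above its fibre minimum has product-Haar measure `≥ c (1+β)^{-128}`, uniformly in the volume,
the outside configuration and the two sites (uniform Lipschitz constant of the ≤ 16·6 plaquette
terms that move ⇒ the sublevel set contains a product of sixteen operator-norm balls of radius
`1/(K(1+β))`; Haar small-ball lower bound as in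
`Literature.Barriers.QuantumFields.haar_unitaryOpBall_ge`, adapted to `SU(3)`). -/
def StarSublevelVolume : Prop :=
  ∃ c : ℝ, 0 < c ∧ ∀ β : ℝ, 0 < β → ∀ (L : ℕ) [NeZero L], 4 ≤ L →
    ∀ (U : GaugeConfig 4 L (Matrix.specialUnitaryGroup (Fin 3) ℂ)) (x y : TorusSite 4 L),
      let star : Edge 4 L → Prop := fun e => e.1 = x ∨ Site.shift e.1 e.2 = x ∨ e.1 = y ∨ Site.shift e.1 e.2 = y
      let refit : GaugeConfig 4 L (Matrix.specialUnitaryGroup (Fin 3) ℂ) →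
          GaugeConfig 4 L (Matrix.specialUnitaryGroup (Fin 3) ℂ) := fun W e => if star e then W e else U e
      let S : GaugeConfig 4 L (Matrix.specialUnitaryGroup (Fin 3) ℂ) → ℝ :=
        fun W => wilsonAction (fundamentalRep (Fin 3)) (refit W)
      let haar : Measure (GaugeConfig 4 L (Matrix.specialUnitaryGroup (Fin 3) ℂ)) :=
        Measure.pi fun _ => haarProbability (Matrix.specialUnitaryGroup (Fin 3) ℂ)
      c * (1 + β) ^ (-(128 : ℝ)) ≤ (haar {W | S W ≤ sInf (Set.range S) + 1 / β}).toReal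

/-- The engine for the Haar-level inequalities (to be vendored as a Literature fact, Nazarov 1993,
Algebra i Analiz 5(4), Thm 1.1 = Turán's lemma on measurable sets): an exponential sum with `n`
real frequencies is controlled on an interval by its values on any subset of positive measure,
with a constant depending on `n` only. Along a one-parameter subgroup `t ↦ W·exp(tX)` of
`SU(3)^16` the band-limited `det diracMatrix (refit ·)` is such a sum with `n ≤ n(N_f)` terms. -/
def NazarovTuranLemma : Prop :=
  ∃ A : ℝ, 0 < A ∧ ∀ (n : ℕ) (lam : Fin (n + 1) → ℝ) (c : Fin (n + 1) → ℂ) (T : ℝ), 0 < T →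
    ∀ (E : Set ℝ), MeasurableSet E → E ⊆ Set.Icc 0 T → 0 < (volume E).toReal →
      let p : ℝ → ℂ := fun t => ∑ k, c k * Complex.exp (Complex.I * (lam k * t))
      ∀ t ∈ Set.Icc 0 T, ‖p t‖ ≤ (A * T / (volume E).toReal) ^ n * sSup ((fun s => ‖p s‖) '' E)

/-! ## Card `conjugate-twin-wells` (negative side) -/

/-- Centre canting beats every real configuration (the one-link kernel of the mechanism):
`Re tr u ≥ -3/2` on `SU(3)` with equality exactly at the two non-trivial centre elements, while
`Re tr u ≥ -1` on the real (conjugation-fixed) locus `SO(3)`. -/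
def CentreCanting : Prop :=
  (∀ u : Matrix.specialUnitaryGroup (Fin 3) ℂ,
      -(3 / 2 : ℝ) ≤ (Matrix.trace (u : Matrix (Fin 3) (Fin 3) ℂ)).re) ∧
  (∀ u : Matrix.specialUnitaryGroup (Fin 3) ℂ,
      (Matrix.trace (u : Matrix (Fin 3) (Fin 3) ℂ)).re = -(3 / 2 : ℝ) ↔
        (u = (suCenter 3 1 : Matrix.specialUnitaryGroup (Fin 3) ℂ) ∨
         u = (suCenter 3 2 : Matrix.specialUnitaryGroup (Fin 3) ℂ))) ∧
  (∀ u : Matrix.specialUnitaryGroup (Fin 3) ℂ,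
      (∀ i j, ((u : Matrix (Fin 3) (Fin 3) ℂ) i j).im = 0) →
        -(1 : ℝ) ≤ (Matrix.trace (u : Matrix (Fin 3) (Fin 3) ℂ)).re)

/-- A TWIN-WELL OUTSIDE: one flavour, `y = x`, some torus, outside `U` and bare mass `m₀ ∈ [-2,2]`
for which the relative small-ball probability of the crux does NOT go to zero with `ε`: there is
`c₀ > 0` such that for every `ε > 0`, for all large `β`, `ν_β(F ≤ ε M_β) ≥ c₀` (and `M_β > 0`).
The card's mechanism produces it from real frustrated corners (conjugate pair of minimiser orbits)
plus mass tuning to a real mode of `D_W(refit s_A; 0)`. Same `let`s as the crux, verbatim. -/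
def TwinWellOutside : Prop :=
  ∃ (L : ℕ) (_ : NeZero L), 4 ≤ L ∧
    ∃ (U : GaugeConfig 4 L (Matrix.specialUnitaryGroup (Fin 3) ℂ)) (x : TorusSite 4 L) (m₀ : ℝ),
      -2 ≤ m₀ ∧ m₀ ≤ 2 ∧
      ∃ c₀ : ℝ, 0 < c₀ ∧ ∀ ε : ℝ, 0 < ε → ∃ β₀ : ℝ, 0 ≤ β₀ ∧ ∀ β : ℝ, β₀ ≤ β →
        let mq : Fin 1 → ℝ := fun _ => m₀
        let star : Edge 4 L → Prop := fun e => e.1 = x ∨ Site.shift e.1 e.2 = x ∨ e.1 = x ∨ Site.shift e.1 e.2 = x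
        let refit : GaugeConfig 4 L (Matrix.specialUnitaryGroup (Fin 3) ℂ) →
            GaugeConfig 4 L (Matrix.specialUnitaryGroup (Fin 3) ℂ) := fun W e => if star e then W e else U e
        let F : GaugeConfig 4 L (Matrix.specialUnitaryGroup (Fin 3) ℂ) → ℝ :=
          fun W => ‖(diracMatrix (refit W) mq).det‖
        let wt : GaugeConfig 4 L (Matrix.specialUnitaryGroup (Fin 3) ℂ) → ℝ :=
          fun W => Real.exp (-(β * wilsonAction (fundamentalRep (Fin 3)) (refit W)))
        let haar : Measure (GaugeConfig 4 L (Matrix.specialUnitaryGroup (Fin 3) ℂ)) :=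
          Measure.pi fun _ => haarProbability (Matrix.specialUnitaryGroup (Fin 3) ℂ)
        let Z : ℝ := ∫ W, wt W ∂haar
        let M : ℝ := (∫ W, F W * wt W ∂haar) / Z
        0 < M ∧ c₀ ≤ (∫ W, (if F W ≤ ε * M then (1 : ℝ) else 0) * wt W ∂haar) / Z

/-- The crux AS TYPED WHEN THIS UNIT WAS DISPATCHED (route rev ≤ 3, item stmt-QuantumFields-11511):
clause (b) WITHOUT the `(1+β)^p` loss. (On 2026-08-16T00:14Z the route restated the decl
`PauliWegnerSea.TiltedFlatness` to the repaired text — item stmt-QuantumFields-14070 — after the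
conditional refutation `Theorems.PauliWegnerSeaTiltedFlatness_refuted`; this copy is byte-identical
to the rev-3 signature and to `Cruxes/TiltedFlatness/Disproof.lean`'s `TiltedFlatnessRev3`.) -/
def TiltedFlatnessRev3 : Prop :=
  ∀ Nf : ℕ, ∃ C p c : ℝ, 0 < C ∧ 0 < c ∧ ∀ β : ℝ, 0 ≤ β → ∀ mq : Fin Nf → ℝ, (∀ f, -2 ≤ mq f ∧ mq f ≤ 2) →
    ∀ (L : ℕ) [NeZero L], 4 ≤ L → ∀ (U : GaugeConfig 4 L (Matrix.specialUnitaryGroup (Fin 3) ℂ)) (x y : TorusSite 4 L),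
      let star : Edge 4 L → Prop := fun e => e.1 = x ∨ Site.shift e.1 e.2 = x ∨ e.1 = y ∨ Site.shift e.1 e.2 = y
      let refit : GaugeConfig 4 L (Matrix.specialUnitaryGroup (Fin 3) ℂ) →
          GaugeConfig 4 L (Matrix.specialUnitaryGroup (Fin 3) ℂ) := fun W e => if star e then W e else U e
      let F : GaugeConfig 4 L (Matrix.specialUnitaryGroup (Fin 3) ℂ) → ℝ :=
        fun W => ‖(diracMatrix (refit W) mq).det‖
      let wt : GaugeConfig 4 L (Matrix.specialUnitaryGroup (Fin 3) ℂ) → ℝ :=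
        fun W => Real.exp (-(β * wilsonAction (fundamentalRep (Fin 3)) (refit W)))
      let haar : Measure (GaugeConfig 4 L (Matrix.specialUnitaryGroup (Fin 3) ℂ)) :=
        Measure.pi fun _ => haarProbability (Matrix.specialUnitaryGroup (Fin 3) ℂ)
      let Z : ℝ := ∫ W, wt W ∂haar
      let M : ℝ := (∫ W, F W * wt W ∂haar) / Z
      (∀ W₀ : GaugeConfig 4 L (Matrix.specialUnitaryGroup (Fin 3) ℂ), F W₀ ≤ C * (1 + β) ^ p * M) ∧
        (0 < M → ∀ ε : ℝ, 0 < ε →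
          (∫ W, (if F W ≤ ε * M then (1 : ℝ) else 0) * wt W ∂haar) / Z ≤ C * ε ^ c)

/-- FIRST LEMMA of the negative line: a twin-well outside refutes the crux as it was typed at
dispatch (rev ≤ 3; pure logic on the `N_f = 1`, `y = x` instance: pick `ε` with `C ε^c < c₀`, then
`β ≥ β₀(ε)`). It does NOT refute the repaired decl (rev 4), by design. -/
def FirstLemmaNeg : Prop :=
  TwinWellOutside → ¬ TiltedFlatnessRev3

/-- The first lemma of the negative line, PROVED (pure logic): a twin-well outside refutes the
crux as typed. -/
theorem firstLemmaNeg_holds : FirstLemmaNeg := by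
  intro hw hT
  obtain ⟨L, hL, h4, U, x, m₀, hm1, hm2, c₀, hc₀, hw⟩ := hw
  haveI : NeZero L := hL
  obtain ⟨C, p, c, hC, hc, h⟩ := hT 1
  set ε : ℝ := (c₀ / (2 * C)) ^ c⁻¹ with hε_def
  have hq : 0 < c₀ / (2 * C) := by positivity
  have hε : 0 < ε := Real.rpow_pos_of_pos hq _
  have hεc : C * ε ^ c = c₀ / 2 := by
    rw [hε_def, Real.rpow_inv_rpow hq.le hc.ne']
    field_simp
  obtain ⟨β₀, hβ₀, hβ⟩ := hw ε hε
  have h1 := h β₀ hβ₀ (fun _ => m₀) (fun _ => ⟨hm1, hm2⟩) L h4 U x x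
  have h2 := hβ β₀ le_rfl
  simp only at h1 h2
  obtain ⟨hM, hlow⟩ := h2
  have hup := h1.2 hM ε hε
  have : c₀ ≤ c₀ / 2 := le_trans hlow (hup.trans_eq hεc)
  linarith

/-- The REPAIRED crux this unit proposed while parked (clause (b) with the same polynomial loss
`C (1+β)^p` as clause (a)). The route adopted exactly this text at rev 4 (item
stmt-QuantumFields-14070): the identity below is `Iff.rfl`. Card untilt-by-sandwich is a line for it. -/
def TiltedFlatnessR : Prop :=
  ∀ Nf : ℕ, ∃ C p c : ℝ, 0 < C ∧ 0 < c ∧ ∀ β : ℝ, 0 ≤ β → ∀ mq : Fin Nf → ℝ, (∀ f, -2 ≤ mq f ∧ mq f ≤ 2) →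
    ∀ (L : ℕ) [NeZero L], 4 ≤ L → ∀ (U : GaugeConfig 4 L (Matrix.specialUnitaryGroup (Fin 3) ℂ)) (x y : TorusSite 4 L),
      let star : Edge 4 L → Prop := fun e => e.1 = x ∨ Site.shift e.1 e.2 = x ∨ e.1 = y ∨ Site.shift e.1 e.2 = y
      let refit : GaugeConfig 4 L (Matrix.specialUnitaryGroup (Fin 3) ℂ) →
          GaugeConfig 4 L (Matrix.specialUnitaryGroup (Fin 3) ℂ) := fun W e => if star e then W e else U e
      let F : GaugeConfig 4 L (Matrix.specialUnitaryGroup (Fin 3) ℂ) → ℝ :=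
        fun W => ‖(diracMatrix (refit W) mq).det‖
      let wt : GaugeConfig 4 L (Matrix.specialUnitaryGroup (Fin 3) ℂ) → ℝ :=
        fun W => Real.exp (-(β * wilsonAction (fundamentalRep (Fin 3)) (refit W)))
      let haar : Measure (GaugeConfig 4 L (Matrix.specialUnitaryGroup (Fin 3) ℂ)) :=
        Measure.pi fun _ => haarProbability (Matrix.specialUnitaryGroup (Fin 3) ℂ)
      let Z : ℝ := ∫ W, wt W ∂haar
      let M : ℝ := (∫ W, F W * wt W ∂haar) / Z
      (∀ W₀ : GaugeConfig 4 L (Matrix.specialUnitaryGroup (Fin 3) ℂ), F W₀ ≤ C * (1 + β) ^ p * M) ∧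
        (0 < M → ∀ ε : ℝ, 0 < ε →
          (∫ W, (if F W ≤ ε * M then (1 : ℝ) else 0) * wt W ∂haar) / Z ≤ C * (1 + β) ^ p * ε ^ c)

/-- The route's current decl (rev 4) IS the repair proposed here. -/
theorem tiltedFlatnessR_iff_current :
    TiltedFlatnessR ↔ Summit.QuantumFields.QCD.Theses.PauliWegnerSea.TiltedFlatness := Iff.rfl

/-- The rev-3 text implies the current one (loss `(1+β)^|p| ≥ 1`). -/
theorem current_of_rev3 :
    TiltedFlatnessRev3 → Summit.QuantumFields.QCD.Theses.PauliWegnerSea.TiltedFlatness := by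
  intro h Nf
  obtain ⟨C, p, c, hC, hc, h⟩ := h Nf
  refine ⟨C, |p|, c, hC, hc, fun β hβ mq hmq L _ hL U x y => ?_⟩
  have h1 := h β hβ mq hmq L hL U x y
  simp only at h1 ⊢
  have hb' : (1 + β) ^ p ≤ (1 + β) ^ |p| :=
    Real.rpow_le_rpow_of_exponent_le (by linarith) (le_abs_self p)
  have hb : (1 : ℝ) ≤ (1 + β) ^ |p| := Real.one_le_rpow (by linarith) (abs_nonneg p)
  obtain ⟨ha, hb2⟩ := h1
  refine ⟨fun W₀ => (ha W₀).trans ?_, fun hM ε hε => (hb2 hM ε hε).trans ?_⟩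
  · refine mul_le_mul_of_nonneg_right (mul_le_mul_of_nonneg_left hb' hC.le) ?_
    exact div_nonneg (integral_nonneg fun _ => mul_nonneg (norm_nonneg _) (Real.exp_pos _).le)
      (integral_nonneg fun _ => (Real.exp_pos _).le)
  · calc C * ε ^ c = C * 1 * ε ^ c := by ring
      _ ≤ C * (1 + β) ^ |p| * ε ^ c :=
        mul_le_mul_of_nonneg_right (mul_le_mul_of_nonneg_left hb hC.le) (Real.rpow_nonneg hε.le c)

end Summit.QuantumFields.QCD.Cruxes.TiltedFlatness.Ideator2

namespace Summit.QuantumFields.QCD.Cruxes.TiltedFlatness.Ideator2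

/-- The abstract untilting sandwich, PROVED. -/
theorem untiltSandwich_holds : UntiltSandwich := by
  intro Ω _ μ _ S F hS hF hF0 hFB m β hβ hm hpos
  obtain ⟨B, hB⟩ := hFB
  -- the weight and its bounds
  have hw_meas : Measurable fun ω => Real.exp (-(β * S ω)) := (measurable_const.mul hS).neg.exp
  have hw_pos : ∀ ω, 0 < Real.exp (-(β * S ω)) := fun ω => Real.exp_pos _
  have hw_le : ∀ ω, Real.exp (-(β * S ω)) ≤ Real.exp (-(β * m)) := fun ω =>
    Real.exp_le_exp.2 (neg_le_neg (mul_le_mul_of_nonneg_left (hm ω) hβ.le))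
  have hw_int : Integrable (fun ω => Real.exp (-(β * S ω))) μ :=
    (integrable_const (Real.exp (-(β * m)))).mono' hw_meas.aestronglyMeasurable
      (ae_of_all _ fun ω => by
        rw [Real.norm_eq_abs, abs_of_pos (hw_pos ω)]; exact hw_le ω)
  -- the good set
  have hA_meas : MeasurableSet {ω | S ω ≤ m + 1 / β} := measurableSet_le hS measurable_const
  have hw_ge : ∀ ω ∈ {ω | S ω ≤ m + 1 / β}, Real.exp (-(β * m + 1)) ≤ Real.exp (-(β * S ω)) := by
    intro ω hω
    apply Real.exp_le_exp.2
    have h1 : β * S ω ≤ β * (m + 1 / β) := mul_le_mul_of_nonneg_left hω hβ.le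
    have h2 : β * (m + 1 / β) = β * m + 1 := by field_simp
    linarith
  -- bounds on Z
  have hZ_le : ∫ ω, Real.exp (-(β * S ω)) ∂μ ≤ Real.exp (-(β * m)) := by
    calc ∫ ω, Real.exp (-(β * S ω)) ∂μ ≤ ∫ _ω, Real.exp (-(β * m)) ∂μ :=
          integral_mono hw_int (integrable_const _) hw_le
      _ = Real.exp (-(β * m)) := by simp
  have hZ_ge : Real.exp (-(β * m + 1)) * (μ {ω | S ω ≤ m + 1 / β}).toReal
      ≤ ∫ ω, Real.exp (-(β * S ω)) ∂μ := by
    calc Real.exp (-(β * m + 1)) * (μ {ω | S ω ≤ m + 1 / β}).toReal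
        = μ.real {ω | S ω ≤ m + 1 / β} • Real.exp (-(β * m + 1)) := by
          rw [smul_eq_mul, mul_comm]; rfl
      _ ≤ ∫ ω in {ω | S ω ≤ m + 1 / β}, Real.exp (-(β * S ω)) ∂μ :=
          setIntegral_ge_of_const_le hA_meas (measure_ne_top μ _) hw_ge hw_int.integrableOn
      _ ≤ ∫ ω, Real.exp (-(β * S ω)) ∂μ :=
          setIntegral_le_integral hw_int (ae_of_all _ fun ω => (hw_pos ω).le)
  have hden_pos : 0 < Real.exp (-(β * m + 1)) * (μ {ω | S ω ≤ m + 1 / β}).toReal :=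
    mul_pos (Real.exp_pos _) hpos
  have hZ_pos : 0 < ∫ ω, Real.exp (-(β * S ω)) ∂μ := lt_of_lt_of_le hden_pos hZ_ge
  refine ⟨fun A hA => ?_, ?_⟩
  · -- clause 1: tilted probability of A
    have hnum : ∫ ω in A, Real.exp (-(β * S ω)) ∂μ ≤ Real.exp (-(β * m)) * (μ A).toReal := by
      have h := norm_setIntegral_le_of_norm_le_const (measure_lt_top μ A)
        (fun ω (_ : ω ∈ A) => show ‖Real.exp (-(β * S ω))‖ ≤ Real.exp (-(β * m)) by
          rw [Real.norm_eq_abs, abs_of_pos (hw_pos ω)]; exact hw_le ω)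
      rw [Real.norm_eq_abs] at h
      exact (le_abs_self _).trans h
    have hexp : Real.exp (-(β * m)) = Real.exp 1 * Real.exp (-(β * m + 1)) := by
      rw [← Real.exp_add]; congr 1; ring
    calc (∫ ω in A, Real.exp (-(β * S ω)) ∂μ) / ∫ ω, Real.exp (-(β * S ω)) ∂μ
        ≤ (Real.exp (-(β * m)) * (μ A).toReal) /
            (Real.exp (-(β * m + 1)) * (μ {ω | S ω ≤ m + 1 / β}).toReal) :=
          div_le_div₀ (by positivity) hnum hden_pos hZ_ge
      _ = Real.exp 1 * (μ A).toReal / (μ {ω | S ω ≤ m + 1 / β}).toReal := by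
          rw [hexp]
          have hne : Real.exp (-(β * m + 1)) ≠ 0 := (Real.exp_pos _).ne'
          field_simp
  · -- clause 2: tilted mean of F
    have hF_int : Integrable F μ :=
      (integrable_const B).mono' hF.aestronglyMeasurable
        (ae_of_all _ fun ω => by rw [Real.norm_eq_abs, abs_of_nonneg (hF0 ω)]; exact hB ω)
    have hFw_int : Integrable (fun ω => F ω * Real.exp (-(β * S ω))) μ :=
      (integrable_const (B * Real.exp (-(β * m)))).mono' (hF.mul hw_meas).aestronglyMeasurable
        (ae_of_all _ fun ω => by
          rw [Real.norm_eq_abs, abs_of_nonneg (mul_nonneg (hF0 ω) (hw_pos ω).le)]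
          exact mul_le_mul (hB ω) (hw_le ω) (hw_pos ω).le ((hF0 ω).trans (hB ω)))
    have hnum : Real.exp (-(β * m + 1)) * ∫ ω in {ω | S ω ≤ m + 1 / β}, F ω ∂μ
        ≤ ∫ ω, F ω * Real.exp (-(β * S ω)) ∂μ := by
      calc Real.exp (-(β * m + 1)) * ∫ ω in {ω | S ω ≤ m + 1 / β}, F ω ∂μ
          = ∫ ω in {ω | S ω ≤ m + 1 / β}, Real.exp (-(β * m + 1)) * F ω ∂μ := by
            rw [integral_const_mul]
        _ ≤ ∫ ω in {ω | S ω ≤ m + 1 / β}, F ω * Real.exp (-(β * S ω)) ∂μ := by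
            apply setIntegral_mono_on (hF_int.const_mul _).integrableOn hFw_int.integrableOn hA_meas
            intro ω hω
            rw [mul_comm]
            exact mul_le_mul_of_nonneg_left (hw_ge ω hω) (hF0 ω)
        _ ≤ ∫ ω, F ω * Real.exp (-(β * S ω)) ∂μ :=
            setIntegral_le_integral hFw_int (ae_of_all _ fun ω => mul_nonneg (hF0 ω) (hw_pos ω).le)
    have hI0 : 0 ≤ ∫ ω in {ω | S ω ≤ m + 1 / β}, F ω ∂μ := integral_nonneg fun ω => hF0 ω
    have hexp : Real.exp (-1) = Real.exp (-(β * m + 1)) / Real.exp (-(β * m)) := by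
      rw [← Real.exp_sub]; congr 1; ring
    calc Real.exp (-1) * ∫ ω in {ω | S ω ≤ m + 1 / β}, F ω ∂μ
        = (Real.exp (-(β * m + 1)) * ∫ ω in {ω | S ω ≤ m + 1 / β}, F ω ∂μ) / Real.exp (-(β * m)) := by
          rw [hexp]; ring
      _ ≤ (∫ ω, F ω * Real.exp (-(β * S ω)) ∂μ) / Real.exp (-(β * m)) :=
          div_le_div_of_nonneg_right hnum (Real.exp_pos _).le
      _ ≤ (∫ ω, F ω * Real.exp (-(β * S ω)) ∂μ) / ∫ ω, Real.exp (-(β * S ω)) ∂μ :=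
          div_le_div_of_nonneg_left (le_trans (mul_nonneg (Real.exp_pos _).le hI0) hnum) hZ_pos hZ_le

end Summit.QuantumFields.QCD.Cruxes.TiltedFlatness.Ideator2
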